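import Mathlib.RingTheory.Derivation.Basic
import Mathlib.LinearAlgebra.Matrix.Determinant.Basic
import Mathlib.LinearAlgebra.Matrix.Block
import Mathlib.LinearAlgebra.Matrix.ToLinearEquiv
import Mathlib.Algebra.BigOperators.Fin
import Mathlib.Algebra.BigOperators.Intervals
import Mathlib.Data.Nat.Choose.Sum
import HarnessLib

/-!
# Wronskians with respect to a derivation

For a derivation `D` of a commutative ring `R` and `f₁, …, fₙ ∈ R`, the **Wronskian**
`W_D(f₁, …, fₙ) = det (D^i f_j)_{0 ≤ i < n, 1 ≤ j ≤ n}` (rows = order of derivative, columns = the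
functions). This file proves the three classical facts about it that are used with `D = d/dz` on a
function field (Brownawell–Masser 1986, Zannier 1993, proof of Theorem 1; Mason 1984):

* `wronskian_update_sum` — replacing one `f_h` by `f₁ + … + fₙ` does not change the Wronskian
  (multilinearity; Zannier 1993, (5));
* `wronskian_smul` / `wronskian_smul_derivation` — **change of derivation**:
  `W_{uD}(f) = u^{n(n−1)/2} · W_D(f)` for `u ∈ R` (the rows of `W_{uD}` are `u^i` times the rows of
  `W_D` plus lower rows: `wronskianMatrix_smul`, an explicit lower-triangular factorisation with
  coefficients `smulIterCoeff`); with `u = dt/dz` this is the classical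
  `W_z(f) = (dt/dz)^{n(n−1)/2} W_t(f)`;
* `exists_const_rel_of_wronskian_eq_zero` — the **Wronskian criterion** over a field: if
  `W_D(f) = 0` then `Σ c_j f_j = 0` for some constants `c_j` (`D c_j = 0`), not all zero; i.e.
  elements linearly independent over the constants of `D` have non-vanishing Wronskian (the classical
  induction: a minimal `F`-linear relation among the columns differentiates to a shorter one).

Mathlib has `Polynomial.wronskian` (two polynomials) and the tree has Wronskians of polynomials /
rational functions (`RothWronskianOne.hwronskian`, `Masser1975.det_iterate_expSum`), but no Wronskian
of an abstract derivation (searched `wronskian`, `Wronskian`): the declarations here are new, in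
`namespace Literature.LinearAlgebra.Matrix`.

## References

* U. Zannier, *Some remarks on the S-unit equation in function fields*, Acta Arith. 64 (1993)
  87–98, p. 89–90 (proof of Theorem 1, (5) and Lemma 1). [Zannier1993]
* R. C. Mason, *Diophantine Equations over Function Fields*, LMS LNS 96 (1984), Ch. I §2. [Mason1984]
-/

namespace Literature.LinearAlgebra.Matrix

open Finset

section defs

variable {R : Type*}

/-- The **Wronskian matrix** `(D^i f_j)_{i,j}` of `f : Fin n → R` with respect to a self-map `D`
of `R` (row index = number of applications of `D`). [folklore] -/
def wronskianMatrix (D : R → R) {n : ℕ} (f : Fin n → R) : Matrix (Fin n) (Fin n) R :=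
  Matrix.of fun i j ↦ D^[(i : ℕ)] (f j)

/-- Entries of the Wronskian matrix. [folklore] -/
@[simp]
theorem wronskianMatrix_apply (D : R → R) {n : ℕ} (f : Fin n → R) (i j : Fin n) :
    wronskianMatrix D f i j = D^[(i : ℕ)] (f j) :=
  rfl

variable [CommRing R]

/-- The **Wronskian** `W_D(f₁, …, fₙ) = det (D^i f_j)` (Zannier 1993, p. 89,
`W(a₁, …, aₙ) = det(a_i^{(j)})`, `i = 1..n`, `j = 0..n−1`; the transpose has the same determinant).
[cite: Zannier1993, proof of Theorem 1, p. 89] -/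
def wronskian (D : R → R) {n : ℕ} (f : Fin n → R) : R :=
  (wronskianMatrix D f).det

/-- Unfolding of `wronskian`. [folklore] -/
theorem wronskian_def (D : R → R) {n : ℕ} (f : Fin n → R) :
    wronskian D f = (wronskianMatrix D f).det :=
  rfl

/-- A determinant all of whose entries lie in a subring lies in that subring. [folklore] -/
theorem det_mem_of_forall_mem {n : Type*} [Fintype n] [DecidableEq n] (S : Subring R)
    (M : Matrix n n R) (h : ∀ i j, M i j ∈ S) : M.det ∈ S := by
  set M' : Matrix n n S := Matrix.of fun i j ↦ ⟨M i j, h i j⟩ with hM'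
  have hmap : M = S.subtype.mapMatrix M' := by
    ext i j
    rfl
  rw [hmap, ← RingHom.map_det]
  exact SetLike.coe_mem _

end defs

/-! ### Derivations: multilinearity and change of derivation -/

section Derivation

variable {S : Type*} [CommSemiring S] {R : Type*} [CommRing R] [Algebra S R]
  (D : Derivation S R R)

/-- Iterates of a derivation are additive. [folklore] -/
theorem iterate_map_add (x y : R) (i : ℕ) : (⇑D)^[i] (x + y) = (⇑D)^[i] x + (⇑D)^[i] y := by
  induction i with
  | zero => rfl
  | succ i ih =>
    rw [Function.iterate_succ_apply', ih, map_add, Function.iterate_succ_apply',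
      Function.iterate_succ_apply']

/-- Iterates of a derivation kill `0`. [folklore] -/
theorem iterate_map_zero (i : ℕ) : (⇑D)^[i] (0 : R) = 0 := by
  induction i with
  | zero => rfl
  | succ i ih => rw [Function.iterate_succ_apply', ih, map_zero]

/-- Iterates of a derivation are additive over finite sums. [folklore] -/
theorem iterate_map_sum {ι : Type*} (s : Finset ι) (g : ι → R) (i : ℕ) :
    (⇑D)^[i] (∑ k ∈ s, g k) = ∑ k ∈ s, (⇑D)^[i] (g k) := by
  induction i with
  | zero => rfl
  | succ i ih =>
    rw [Function.iterate_succ_apply', ih, map_sum]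
    simp only [Function.iterate_succ_apply']

/-- Iterates of a derivation commute with multiplication by a `D`-constant. [folklore] -/
theorem iterate_const_mul (c x : R) (hc : D c = 0) (i : ℕ) :
    (⇑D)^[i] (c * x) = c * (⇑D)^[i] x := by
  induction i with
  | zero => rfl
  | succ i ih =>
    rw [Function.iterate_succ_apply', ih, Derivation.leibniz, hc, Function.iterate_succ_apply']
    simp only [smul_eq_mul, mul_zero, add_zero]

/-- **Column operation** (Zannier 1993, (5)): replacing `f_{j₀}` by `f₁ + … + fₙ` leaves the Wronskian
unchanged, `W(f₁, …, f_{h−1}, b, f_{h+1}, …, fₙ) = W(f₁, …, fₙ)` for `b = Σ f_j` (multilinearity of the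
determinant in the columns and additivity of `D^i`). [cite: Zannier1993, proof of Theorem 1, (5)] -/
theorem wronskian_update_sum {n : ℕ} (f : Fin n → R) (j₀ : Fin n) :
    wronskian D (Function.update f j₀ (∑ j, f j)) = wronskian D f := by
  classical
  unfold wronskian
  have h : wronskianMatrix D (Function.update f j₀ (∑ j, f j)) =
      (wronskianMatrix D f).updateCol j₀ fun k ↦ ∑ i, (1 : Fin n → R) i • wronskianMatrix D f k i := by
    ext k j
    rw [Matrix.updateCol_apply]
    simp only [wronskianMatrix_apply, Pi.one_apply, one_smul]
    by_cases hj : j = j₀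
    · rw [if_pos hj, hj, Function.update_self, iterate_map_sum]
    · rw [if_neg hj, Function.update_of_ne hj]
  rw [h, Matrix.det_updateCol_sum, Pi.one_apply, one_smul]

/-- Shift of a sequence by one (`(c₀, c₁, …) ↦ (0, c₀, c₁, …)`), used for the coefficients of
`(uD)^i` in terms of the `D^l`. [folklore] -/
def shiftSeq (c : ℕ → R) : ℕ → R
  | 0 => 0
  | l + 1 => c l

/-- `shiftSeq c 0 = 0`. [folklore] -/
@[simp]
theorem shiftSeq_zero (c : ℕ → R) : shiftSeq c 0 = 0 :=
  rfl

/-- `shiftSeq c (l + 1) = c l`. [folklore] -/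
@[simp]
theorem shiftSeq_succ (c : ℕ → R) (l : ℕ) : shiftSeq c (l + 1) = c l :=
  rfl

/-- The coefficients `c_{i,l} ∈ R` with `(uD)^i = Σ_l c_{i,l} D^l` (`c_{0,l} = δ_{0,l}`,
`c_{i+1,l} = u D(c_{i,l}) + u c_{i,l−1}`); lower triangular with `c_{i,i} = u^i`. [folklore] -/
def smulIterCoeff (u : R) : ℕ → ℕ → R
  | 0 => fun l ↦ if l = 0 then 1 else 0
  | i + 1 => fun l ↦ u * D (smulIterCoeff u i l) + u * shiftSeq (smulIterCoeff u i) l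

/-- `c_{0,l} = δ_{0,l}`. [folklore] -/
theorem smulIterCoeff_zero (u : R) (l : ℕ) :
    smulIterCoeff D u 0 l = if l = 0 then 1 else 0 :=
  rfl

/-- The recursion `c_{i+1,l} = u D(c_{i,l}) + u c_{i,l−1}`. [folklore] -/
theorem smulIterCoeff_succ (u : R) (i l : ℕ) :
    smulIterCoeff D u (i + 1) l =
      u * D (smulIterCoeff D u i l) + u * shiftSeq (smulIterCoeff D u i) l :=
  rfl

/-- `c_{i,l} = 0` for `l > i`. [folklore] -/
theorem smulIterCoeff_eq_zero_of_lt (u : R) {i l : ℕ} (h : i < l) : smulIterCoeff D u i l = 0 := by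
  induction i generalizing l with
  | zero => rw [smulIterCoeff_zero, if_neg (by omega)]
  | succ i ih =>
    rw [smulIterCoeff_succ, ih (by omega), map_zero, mul_zero, zero_add]
    cases l with
    | zero => omega
    | succ l => rw [shiftSeq_succ, ih (by omega), mul_zero]

/-- `c_{i,i} = u^i`. [folklore] -/
theorem smulIterCoeff_self (u : R) (i : ℕ) : smulIterCoeff D u i i = u ^ i := by
  induction i with
  | zero => rw [smulIterCoeff_zero, if_pos rfl, pow_zero]
  | succ i ih =>
    rw [smulIterCoeff_succ, smulIterCoeff_eq_zero_of_lt D u (Nat.lt_succ_self i), map_zero,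
      mul_zero, zero_add, shiftSeq_succ, ih, pow_succ, mul_comm]

/-- **Expansion of `(uD)^i`**: `(uD)^i x = Σ_{l<N} c_{i,l} D^l x` for any `N > i`. [folklore] -/
theorem iterate_smul_apply_eq_sum (u x : R) {i N : ℕ} (h : i < N) :
    (fun y ↦ u * D y)^[i] x = ∑ l ∈ range N, smulIterCoeff D u i l * (⇑D)^[l] x := by
  induction i with
  | zero =>
    rw [Function.iterate_zero, id_eq, Finset.sum_eq_single 0]
    · rw [smulIterCoeff_zero, if_pos rfl, one_mul, Function.iterate_zero, id_eq]
    · intro l _ hl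
      rw [smulIterCoeff_zero, if_neg hl, zero_mul]
    · intro h0
      exact absurd (Finset.mem_range.2 h) h0
  | succ i ih =>
    have hi : i < N := by omega
    rw [Function.iterate_succ_apply', ih hi, map_sum, Finset.mul_sum]
    simp_rw [Derivation.leibniz, smul_eq_mul, mul_add, Finset.sum_add_distrib, smulIterCoeff_succ,
      add_mul, Finset.sum_add_distrib]
    rw [add_comm]
    congr 1
    · exact Finset.sum_congr rfl fun l _ ↦ by ring
    · -- reindex `l ↦ l + 1`; the top term vanishes since `c_{i,N-1} = 0`
      obtain ⟨M, rfl⟩ : ∃ M, N = M + 1 := ⟨N - 1, by omega⟩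
      rw [Finset.sum_range_succ, smulIterCoeff_eq_zero_of_lt D u (show i < M by omega), zero_mul,
        mul_zero, add_zero, Finset.sum_range_succ']
      simp only [shiftSeq_zero, shiftSeq_succ, mul_zero, zero_mul, add_zero,
        Function.iterate_succ_apply']
      exact Finset.sum_congr rfl fun l _ ↦ by ring

/-- **Lower-triangular factorisation** `W_{uD}(f) = C · W_D(f)`, `C = (c_{i,l})`. [folklore] -/
theorem wronskianMatrix_smul {n : ℕ} (u : R) (f : Fin n → R) :
    wronskianMatrix (fun y ↦ u * D y) f =
      Matrix.of (fun i l : Fin n ↦ smulIterCoeff D u i l) * wronskianMatrix D f := by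
  ext i j
  rw [Matrix.mul_apply, wronskianMatrix_apply, iterate_smul_apply_eq_sum D u (f j) i.isLt,
    Finset.sum_range]
  rfl

/-- `det C = Π u^i = u^{n(n−1)/2}`. [folklore] -/
theorem det_smulIterCoeff (n : ℕ) (u : R) :
    (Matrix.of fun i l : Fin n ↦ smulIterCoeff D u i l).det = u ^ (n.choose 2) := by
  rw [Matrix.det_of_lowerTriangular]
  · simp only [Matrix.of_apply, smulIterCoeff_self]
    rw [Finset.prod_pow_eq_pow_sum, Fin.sum_univ_eq_sum_range (fun i ↦ i) n, Finset.sum_range_id,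
      Nat.choose_two_right]
  · intro i j hij
    exact smulIterCoeff_eq_zero_of_lt D u (Fin.lt_def.1 (OrderDual.toDual_lt_toDual.1 hij))

/-- **Change of derivation for Wronskians**: `W_{uD}(f₁, …, fₙ) = u^{n(n−1)/2} · W_D(f₁, …, fₙ)`
(the classical `W_z = (dt/dz)^{n(n−1)/2} W_t` for `d/dz = (dt/dz) d/dt`; Zannier 1993 Lemma 1 /
Brownawell–Masser 1986 Lemma 2, the term `−C(n,2) v(dz/dt_v)`). [cite: Zannier1993, Lemma 1] -/
theorem wronskian_smul {n : ℕ} (u : R) (f : Fin n → R) :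
    wronskian (fun y ↦ u * D y) f = u ^ (n.choose 2) * wronskian D f := by
  rw [wronskian, wronskianMatrix_smul, Matrix.det_mul, det_smulIterCoeff, wronskian]

/-- `wronskian_smul` for the derivation `u • D`. [cite: Zannier1993, Lemma 1] -/
theorem wronskian_smul_derivation {n : ℕ} (u : R) (f : Fin n → R) :
    wronskian (⇑(u • D)) f = u ^ (n.choose 2) * wronskian D f := by
  rw [show (⇑(u • D) : R → R) = fun y ↦ u * D y from
    funext fun y ↦ by rw [Derivation.smul_apply, smul_eq_mul]]
  exact wronskian_smul D u f

end Derivation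

/-! ### The Wronskian criterion for linear independence over the constants -/

section Field

variable {S : Type*} [CommSemiring S] {K : Type*} [Field K] [Algebra S K] (D : Derivation S K K)

/-- **The induction behind the Wronskian criterion.** If the columns `(f_j, D f_j, …, D^{n−1} f_j)`
satisfy a non-trivial `K`-linear relation `Σ_j μ_j D^i f_j = 0` (`0 ≤ i < n`), then the `f_j` satisfy
a non-trivial linear relation with *constant* coefficients (`D c_j = 0`). Proof: induct on `n`; if some
`μ_j = 0` drop that index; otherwise normalise `μ_n = 1` and differentiate the relations — either all
`D μ_j = 0` (done) or `(D μ_j)_{j<n}` is a shorter non-trivial relation. [folklore] -/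
theorem exists_const_rel_of_forall_sum_eq_zero :
    ∀ {n : ℕ} (f : Fin n → K) (μ : Fin n → K), μ ≠ 0 →
      (∀ i : Fin n, ∑ j, μ j * (⇑D)^[(i : ℕ)] (f j) = 0) →
      ∃ c : Fin n → K, (∀ j, D (c j) = 0) ∧ c ≠ 0 ∧ ∑ j, c j * f j = 0 := by
  intro n
  induction n with
  | zero =>
    intro f μ hμ _
    exact absurd (Subsingleton.elim μ 0) hμ
  | succ n ih =>
    intro f μ hμ hrel
    by_cases hzero : ∃ j₀, μ j₀ = 0
    · -- drop an index with `μ_{j₀} = 0`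
      obtain ⟨j₀, hj₀⟩ := hzero
      set f' : Fin n → K := fun j ↦ f (j₀.succAbove j) with hf'
      set μ' : Fin n → K := fun j ↦ μ (j₀.succAbove j) with hμ'_def
      have hμ' : μ' ≠ 0 := by
        intro h
        apply hμ
        funext j
        by_cases hj : j = j₀
        · rw [hj, hj₀, Pi.zero_apply]
        · obtain ⟨j', rfl⟩ := Fin.exists_succAbove_eq hj
          exact congrFun h j'
      have hrel' : ∀ i : Fin n, ∑ j, μ' j * (⇑D)^[(i : ℕ)] (f' j) = 0 := by
        intro i
        have h1 := hrel i.castSucc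
        rw [Fin.sum_univ_succAbove _ j₀, hj₀, zero_mul, zero_add, Fin.val_castSucc] at h1
        exact h1
      obtain ⟨c', hc'D, hc'0, hc'rel⟩ := ih f' μ' hμ' hrel'
      refine ⟨Fin.insertNth j₀ 0 c', fun j ↦ ?_, fun h ↦ hc'0 ?_, ?_⟩
      · by_cases hj : j = j₀
        · rw [hj, Fin.insertNth_apply_same, map_zero]
        · obtain ⟨j', rfl⟩ := Fin.exists_succAbove_eq hj
          rw [Fin.insertNth_apply_succAbove]
          exact hc'D j'
      · funext j'
        have := congrFun h (j₀.succAbove j')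
        rwa [Fin.insertNth_apply_succAbove] at this
      · rw [Fin.sum_univ_succAbove _ j₀, Fin.insertNth_apply_same, zero_mul, zero_add]
        simp only [Fin.insertNth_apply_succAbove]
        exact hc'rel
    · -- all `μ_j ≠ 0`: normalise `μ_last = 1` and differentiate
      push Not at hzero
      set ν : Fin (n + 1) → K := fun j ↦ μ j * (μ (Fin.last n))⁻¹ with hν_def
      have hνlast : ν (Fin.last n) = 1 := mul_inv_cancel₀ (hzero _)
      have hνrel : ∀ i : Fin (n + 1), ∑ j, ν j * (⇑D)^[(i : ℕ)] (f j) = 0 := by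
        intro i
        have h1 := hrel i
        have : ∑ j, ν j * (⇑D)^[(i : ℕ)] (f j) = (∑ j, μ j * (⇑D)^[(i : ℕ)] (f j)) * (μ (Fin.last n))⁻¹ := by
          rw [Finset.sum_mul]
          exact Finset.sum_congr rfl fun j _ ↦ by simp only [hν_def]; ring
        rw [this, h1, zero_mul]
      -- differentiated relations: `Σ_j D(ν_j) D^i f_j = 0` for `i < n`
      have hDrel : ∀ i : Fin n, ∑ j : Fin (n + 1), D (ν j) * (⇑D)^[(i : ℕ)] (f j) = 0 := by
        intro i
        have h1 := congrArg D (hνrel i.castSucc)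
        rw [map_sum, map_zero] at h1
        simp_rw [Derivation.leibniz, smul_eq_mul, Finset.sum_add_distrib, Fin.val_castSucc] at h1
        have h2 : ∑ j, ν j * D ((⇑D)^[(i : ℕ)] (f j)) = 0 := by
          have := hνrel i.succ
          simp_rw [Fin.val_succ, Function.iterate_succ_apply'] at this
          exact this
        rw [h2, zero_add] at h1
        simpa only [mul_comm] using h1
      by_cases hνconst : ∀ j : Fin n, D (ν j.castSucc) = 0
      · -- `ν` is a vector of constants
        refine ⟨ν, fun j ↦ ?_, fun h ↦ ?_, ?_⟩
        · rcases Fin.eq_castSucc_or_eq_last j with ⟨j', rfl⟩ | rfl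
          · exact hνconst j'
          · rw [hνlast, Derivation.map_one_eq_zero]
        · have := congrFun h (Fin.last n)
          rw [hνlast, Pi.zero_apply] at this
          exact one_ne_zero this
        · have := hνrel 0
          simpa using this
      · -- a shorter non-trivial relation among `f_1, …, f_n`
        push Not at hνconst
        set f' : Fin n → K := fun j ↦ f j.castSucc with hf'
        set μ' : Fin n → K := fun j ↦ D (ν j.castSucc) with hμ'_def
        have hμ' : μ' ≠ 0 := by
          obtain ⟨j, hj⟩ := hνconst
          exact fun h ↦ hj (congrFun h j)
        have hrel' : ∀ i : Fin n, ∑ j, μ' j * (⇑D)^[(i : ℕ)] (f' j) = 0 := by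
          intro i
          have := hDrel i
          rw [Fin.sum_univ_castSucc, hνlast, Derivation.map_one_eq_zero, zero_mul, add_zero] at this
          exact this
        obtain ⟨c', hc'D, hc'0, hc'rel⟩ := ih f' μ' hμ' hrel'
        refine ⟨Fin.snoc c' 0, fun j ↦ ?_, fun h ↦ hc'0 ?_, ?_⟩
        · rcases Fin.eq_castSucc_or_eq_last j with ⟨j', rfl⟩ | rfl
          · rw [Fin.snoc_castSucc]
            exact hc'D j'
          · rw [Fin.snoc_last, map_zero]
        · funext j'
          have := congrFun h j'.castSucc
          rwa [Fin.snoc_castSucc] at this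
        · rw [Fin.sum_univ_castSucc, Fin.snoc_last, zero_mul, add_zero]
          simp only [Fin.snoc_castSucc]
          exact hc'rel

/-- **The Wronskian criterion.** Over a field `K` with a derivation `D`: if `W_D(f₁, …, fₙ) = 0` then
there are constants `c₁, …, cₙ` (`D c_j = 0`), not all zero, with `Σ c_j f_j = 0`. Equivalently,
elements of `K` linearly independent over the field of constants of `D` have non-zero Wronskian
(Zannier 1993, p. 89: "Since `a₁, …, aₙ` are linearly independent over the constant field `k` of the
derivation `d/dz`, `W` does not vanish"). [cite: Zannier1993, proof of Theorem 1, p. 89] -/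
theorem exists_const_rel_of_wronskian_eq_zero {n : ℕ} (f : Fin n → K) (h : wronskian D f = 0) :
    ∃ c : Fin n → K, (∀ j, D (c j) = 0) ∧ c ≠ 0 ∧ ∑ j, c j * f j = 0 := by
  classical
  obtain ⟨μ, hμ, hμv⟩ := Matrix.exists_mulVec_eq_zero_iff.2 h
  refine exists_const_rel_of_forall_sum_eq_zero D f μ hμ fun i ↦ ?_
  have := congrFun hμv i
  rw [Pi.zero_apply, Matrix.mulVec, dotProduct] at this
  simpa only [wronskianMatrix_apply, mul_comm] using this

/-- Contrapositive form: if the only constant relation among the `f_j` is the trivial one, then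
`W_D(f) ≠ 0`. [cite: Zannier1993, proof of Theorem 1, p. 89] -/
theorem wronskian_ne_zero_of_forall_const_rel {n : ℕ} (f : Fin n → K)
    (h : ∀ c : Fin n → K, (∀ j, D (c j) = 0) → ∑ j, c j * f j = 0 → c = 0) :
    wronskian D f ≠ 0 := by
  intro hW
  obtain ⟨c, hcD, hc0, hcrel⟩ := exists_const_rel_of_wronskian_eq_zero D f hW
  exact hc0 (h c hcD hcrel)

end Field

end Literature.LinearAlgebra.Matrix
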